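/-
Copyright (c) 2026. All rights reserved.
Released under Apache 2.0 license as described in the file LICENSE.
Authors: solo-Langlands-informed (ideation tier, family 6).
-/
import Literature.NumberTheory.PAdicHodge.TateTwistInvariantsRelative
import Literature.NumberTheory.PAdicHodge.CompletedAlgClosurePadicNorm
import Literature.NumberTheory.LocalFields.PadicComplexIwasawaLogarithm
import Literature.NumberTheory.LocalFields.PadicExpLogHomomorphisms
import HarnessLib

/-!
# `log χ` is not a coboundary: the class of the logarithm of the cyclotomic character in
# `Fun(Gal(F̄/M), ℂ_F) / {h ↦ h c − c}` is non-zero (Tate 1967, §3.3; Serre, III-A.2)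

Topic `Literature/NumberTheory/PAdicHodge`; namespace `Literature.NumberTheory.PAdicHodge`. Sequel of
`TateTwistInvariantsRelative` (Tate's `H⁰(Gal(F̄/M), ℂ_F(χ^j)) = 0`, `j ≠ 0`, for an intermediate field `M`
finite over the `p`-adic field `F`, inside `ℂ_F`) and of `CompletedAlgClosurePadicNorm` (`ℂ_F` as the complete
ultrametric normed `ℚ_p`-algebra `PadicCompletedAlgClosure F p hp`, on which the tree's `p`-adic exponential and
logarithm at the sharp radius `r_p = p^{-1/(p-1)}` — `LocalFields/PadicExpLogHomomorphisms`, Robert V.4.2 — apply).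

THE STATEMENT. Let `χ = GaloisRep.cyclotomicCharacter F p : Γ_F → ℤ_p^×`, `M ⊆ F̄` an intermediate field finite
over `F` on whose fixator `H = Gal(F̄/M)` the character is `r_p`-close to `1` (`|1 − χ(σ)|_p < r_p`, which holds on
an open subgroup), and write `log χ(σ) = plog(ι χ(σ)) ∈ ℂ_F` (`ι : ℚ_p → F → ℂ_F`). Then **there is NO `c ∈ ℂ_F`
with `log χ(σ) = σ(c) − c` for all `σ ∈ H`** (`PadicCompletedAlgClosure.not_exists_plog_cyclotomicCharacter_eq_gal_sub`),
and more generally no `c` with `m · log χ(σ) = σ(c) − c` for an `H`-invariant `m ≠ 0`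
(`…_mul_plog_…`). This is the additive shadow of Tate's theorem: in Tate's language
`H¹(H, ℂ_F) ≅ M · [log χ]` is one-dimensional with generator the class of `log χ` (Tate 1967, §3.3,
Theorem 2; Serre, *Abelian ℓ-adic representations*, III-A.2, Proposition 2 and its use in III-A.5/A.6); we
prove exactly the non-vanishing of that class, which is the form used in the proof of Tate's "Hodge–Tate
characters are locally algebraic" (III-A.6).

THE PROOF (Tate's exponential trick). If `log χ(σ) = σ c − c` on `H`, pick `N = p^k` with `‖N c‖ < r_p` and put
`u = exp(N c) ∈ ℂ_F^×`. The Galois action is isometric and continuous, so it commutes with `exp` and `plog`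
(`gal_exp`, `gal_plog`); hence `σ u = exp(N σ c) = exp(N c + N log χ(σ)) = u · exp(log χ(σ))^N = χ(σ)^N · u`
(`exp_add`, `exp (n x) = (exp x)^n`, `exp ∘ plog = id` on the sharp ball — all from `PadicExpLogHomomorphisms`).
So `u` is a non-zero vector of `ℂ_F` on which `H` acts through `χ^N`, `N ≠ 0`, contradicting
`CompletedAlgClosure.eq_zero_of_forall_fixing_smul_eq_cyclotomicCharacter_pow` (Tate's `H⁰ = 0`).

§1 transports the action of `Γ_F` to the synonym (`PadicCompletedAlgClosure.gal`, an isometric ring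
automorphism fixing `ℚ_p`; `gal_plog`, `gal_exp`); §2 is the theorem. Use: input (R6) of the relative
(inside-`ℂ_F`) proof of Tate's theorem «de Rham / Hodge–Tate rank-one characters of `Γ_F` are locally algebraic»
for `[F : ℚ_p] > 1` (the `n = 1` conjunct of `Summit.Langlands`, ℓ-adic places of degree `> 1`).

## References
* [Tate1967] J. T. Tate, *p-divisible groups*, Proc. Conf. Local Fields (Driebergen, 1966), Springer 1967, §3.3 Theorem 2.
* [SerreAbelianLadic1968] J.-P. Serre, *Abelian ℓ-adic representations and elliptic curves*, Benjamin 1968, Ch. III, Appendix A.2 (Proposition 2), A.5–A.6.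
* [Robert2000PadicAnalysis] A. M. Robert, *A Course in p-adic Analysis*, GTM 198, Ch. V §4.2 (the exponential and logarithm at the sharp radius).
* [FontaineOuyang2022] J.-M. Fontaine, Y. Ouyang, *Theory of p-adic Galois representations*, §3.1 (the action of `G_K` on `C = \widehat{K̄}`).
* [NeukirchANT1999] J. Neukirch, *Algebraic Number Theory*, Ch. II (4.8) (extension of absolute values).
-/

noncomputable section

open NormedSpace IsUltrametricDist ValuativeRel

namespace Literature.NumberTheory.PAdicHodge

open Literature.NumberTheory.GaloisRepresentations
open Literature.NumberTheory.GaloisRepresentations.IsNonarchimedeanLocalField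
open Literature.NumberTheory.LocalFields
open Literature.NumberTheory.Transcendental
open Field

variable {F : Type} [Field F] [ValuativeRel F] [TopologicalSpace F] [IsNonarchimedeanLocalField F]
  [CharZero F] {p : ℕ} [hprime : Fact p.Prime] (hp : valuation F p < 1)

namespace PadicCompletedAlgClosure

/-! ## §1 The Galois action on the `ℚ_p`-normalised copy of `ℂ_F` -/

/-- The action of `σ ∈ Γ_F` on `ℂ_F`, read on the synonym `PadicCompletedAlgClosure F p hp` (a ring
automorphism; it is `CompletedAlgClosure.galRingHom σ` transported along the identity `toC`). [folklore] -/
def gal (σ : absoluteGaloisGroup F) : PadicCompletedAlgClosure F p hp →+* PadicCompletedAlgClosure F p hp :=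
  ((toC hp).symm.toRingHom.comp (CompletedAlgClosure.galRingHom σ)).comp (toC hp).toRingHom

omit [CharZero F] hprime in
/-- Unfolding: `toC (gal σ x) = σ • toC x` (the action of `Γ_F` on `ℂ_F = \widehat{F̄}`). [cite: FontaineOuyang2022, §3.1] -/
@[simp] theorem toC_gal (σ : absoluteGaloisGroup F) (x : PadicCompletedAlgClosure F p hp) :
    toC hp (gal hp σ x) = σ • toC hp x := rfl

/-- **`Γ_F` acts by isometries** of the `ℚ_p`-normalised norm (`‖σ • x‖_{ℂ_F} = ‖x‖_{ℂ_F}`,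
`CompletedAlgClosure.norm_smul`, and the synonym norm is a power of it). [cite: Tate1967, §3.3] -/
theorem norm_gal (σ : absoluteGaloisGroup F) (x : PadicCompletedAlgClosure F p hp) : ‖gal hp σ x‖ = ‖x‖ := by
  rw [norm_def, norm_def, toC_gal, CompletedAlgClosure.norm_smul]

/-- `Γ_F` acts continuously on the synonym (same topology as `ℂ_F`). [cite: FontaineOuyang2022, §3.1] -/
theorem continuous_gal (σ : absoluteGaloisGroup F) : Continuous (gal hp σ) :=
  (AddMonoidHomClass.isometry_of_norm (gal hp σ) (norm_gal hp σ)).continuous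

/-- `Γ_F` fixes `ℚ_p ⊆ ℂ_F` (`ℚ_p → F → ℂ_F`; the action is `F`-linear). [cite: FontaineOuyang2022, §3.1] -/
@[simp] theorem gal_algebraMap (σ : absoluteGaloisGroup F) (q : ℚ_[p]) :
    gal hp σ (algebraMap ℚ_[p] (PadicCompletedAlgClosure F p hp) q) =
      algebraMap ℚ_[p] (PadicCompletedAlgClosure F p hp) q := by
  apply (toC hp).injective
  rw [toC_gal, algebraMap_padic_apply, CompletedAlgClosure.smul_algebraMap]

omit [CharZero F] hprime in
/-- `Γ_F` fixes the natural numbers. [cite: FontaineOuyang2022, §3.1] -/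
theorem gal_natCast (σ : absoluteGaloisGroup F) (n : ℕ) :
    gal hp σ (n : PadicCompletedAlgClosure F p hp) = n := map_natCast _ n

/-- **The Galois action commutes with the logarithm** on `1 + 𝔪_{ℂ_F}`: `σ(log y) = log(σ y)` for
`‖1 − y‖ < 1` (the coefficients of the series are rational; `LocalFields.plog_map` for the isometric ring
homomorphism `gal σ`). [cite: Robert2000PadicAnalysis, Ch. V §4.5 Theorem (4)] -/
theorem gal_plog (σ : absoluteGaloisGroup F) {y : PadicCompletedAlgClosure F p hp} (hy : ‖1 - y‖ < 1) :
    gal hp σ (PadicExp.plog y) = PadicExp.plog (gal hp σ y) :=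
  plog_map (p := p) (gal hp σ) (norm_gal hp σ) hy

/-- **The Galois action commutes with the exponential** on the sharp ball: `σ(exp x) = exp(σ x)` for
`‖x‖ < r_p` (the exponential series has rational coefficients and `σ` is continuous).
[cite: Robert2000PadicAnalysis, Ch. V §4.2 Proposition 3] -/
theorem gal_exp (σ : absoluteGaloisGroup F) {x : PadicCompletedAlgClosure F p hp}
    (hx : ‖x‖ < (p : ℝ) ^ (-(1 : ℝ) / ((p : ℝ) - 1))) : gal hp σ (exp x) = exp (gal hp σ x) := by
  have h := (hasSum_exp_of_norm_lt_radius (p := p) hx).map (gal hp σ) (continuous_gal hp σ)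
  have hx' : ‖gal hp σ x‖ < (p : ℝ) ^ (-(1 : ℝ) / ((p : ℝ) - 1)) := by rwa [norm_gal]
  have h2 := hasSum_exp_of_norm_lt_radius (p := p) hx'
  have h1 : HasSum (fun n : ℕ => gal hp σ x ^ n / (Nat.factorial n : PadicCompletedAlgClosure F p hp))
      (gal hp σ (exp x)) := by
    refine h.congr_fun fun n => ?_
    simp only [Function.comp_apply, map_div₀, map_pow, map_natCast]
  exact h1.unique h2

/-- The norm of `p^k` in the synonym is `p^{-k}` (`‖ι q‖ = |q|_p`: the rescaled norm extends the `p`-adic absolute value). [cite: NeukirchANT1999, Ch. II (4.8)] -/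
theorem norm_natCast_prime_pow (k : ℕ) : ‖((p ^ k : ℕ) : PadicCompletedAlgClosure F p hp)‖ = ((p : ℝ)⁻¹) ^ k := by
  have h : ((p ^ k : ℕ) : PadicCompletedAlgClosure F p hp) =
      algebraMap ℚ_[p] (PadicCompletedAlgClosure F p hp) ((p : ℚ_[p]) ^ k) := by
    rw [map_pow, map_natCast, Nat.cast_pow]
  rw [h, norm_algebraMap_padic, norm_pow, Padic.norm_p]

/-! ## §2 `[log χ] ≠ 0` -/

/-- **The class of `log χ` in `H¹(Gal(F̄/M), ℂ_F)` is non-zero** (Tate 1967 §3.3; Serre III-A.2 Prop. 2 /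
A.6). Let `M ⊆ F̄` be an intermediate field finite over `F` such that `|1 − χ(σ)|_p < r_p = p^{-1/(p-1)}` for
every `σ ∈ Γ_F` fixing `M` pointwise (`χ` the cyclotomic character). Then there is no `c ∈ ℂ_F` with
`plog(ι χ(σ)) = σ(c) − c` for all such `σ` (`ι : ℚ_p → ℂ_F`; everything read on the `ℚ_p`-normalised copy
`PadicCompletedAlgClosure F p hp` of `ℂ_F`, where `plog` is the tree's logarithm series). Proof: Tate's
exponential trick, `u = exp(p^k c)` would be a non-zero vector with `σ u = χ(σ)^{p^k} u`, against
`H⁰(Gal(F̄/M), ℂ_F(χ^{p^k})) = 0`. [cite: Tate1967, §3.3 Theorem 2] [cite: SerreAbelianLadic1968, Ch. III §A.2 Proposition 2] -/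
theorem not_exists_plog_cyclotomicCharacter_eq_gal_sub (M : IntermediateField F (NormedAlgClosure F))
    [FiniteDimensional F M]
    (hχ : ∀ σ : absoluteGaloisGroup F, (∀ y ∈ M, σ • y = y) →
      ‖(1 : ℚ_[p]) - (((GaloisRep.cyclotomicCharacter F p σ : ℤ_[p]ˣ) : ℤ_[p]) : ℚ_[p])‖ <
        (p : ℝ) ^ (-(1 : ℝ) / ((p : ℝ) - 1))) :
    ¬ ∃ c : PadicCompletedAlgClosure F p hp, ∀ σ : absoluteGaloisGroup F, (∀ y ∈ M, σ • y = y) →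
      PadicExp.plog (algebraMap ℚ_[p] (PadicCompletedAlgClosure F p hp)
        (((GaloisRep.cyclotomicCharacter F p σ : ℤ_[p]ˣ) : ℤ_[p]) : ℚ_[p])) = gal hp σ c - c := by
  rintro ⟨c, hc⟩
  set r : ℝ := (p : ℝ) ^ (-(1 : ℝ) / ((p : ℝ) - 1)) with hr
  have hr0 : 0 < r := rpow_radius_pos p
  have hp1 : (1 : ℝ) < p := by exact_mod_cast hprime.out.one_lt
  -- choose `N = p^k` with `‖N c‖ < r`
  obtain ⟨k, hk⟩ := exists_pow_lt_of_lt_one (div_pos hr0 (by positivity : (0 : ℝ) < ‖c‖ + 1))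
    (inv_lt_one_of_one_lt₀ hp1)
  set N : ℕ := p ^ k with hN
  have hN0 : N ≠ 0 := pow_ne_zero k hprime.out.ne_zero
  set z : PadicCompletedAlgClosure F p hp := (N : PadicCompletedAlgClosure F p hp) * c with hz
  have hzr : ‖z‖ < r := by
    rw [hz, norm_mul, hN, norm_natCast_prime_pow]
    calc ((p : ℝ)⁻¹) ^ k * ‖c‖ ≤ ((p : ℝ)⁻¹) ^ k * (‖c‖ + 1) := by gcongr; linarith
      _ < r / (‖c‖ + 1) * (‖c‖ + 1) := by gcongr
      _ = r := div_mul_cancel₀ r (by positivity)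
  set u : PadicCompletedAlgClosure F p hp := exp z with hu
  have hu0 : u ≠ 0 := exp_ne_zero_of_norm_lt_radius (p := p) hzr
  -- `σ u = χ(σ)^N u` for `σ` fixing `M`
  have hgal : ∀ σ : absoluteGaloisGroup F, (∀ y ∈ M, σ • y = y) →
      gal hp σ u = algebraMap ℚ_[p] (PadicCompletedAlgClosure F p hp)
        (((GaloisRep.cyclotomicCharacter F p σ : ℤ_[p]ˣ) : ℤ_[p]) : ℚ_[p]) ^ N * u := by
    intro σ hσ
    set a : PadicCompletedAlgClosure F p hp := algebraMap ℚ_[p] (PadicCompletedAlgClosure F p hp)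
      (((GaloisRep.cyclotomicCharacter F p σ : ℤ_[p]ˣ) : ℤ_[p]) : ℚ_[p]) with ha
    have ha1 : ‖1 - a‖ < r := by
      rw [ha, ← map_one (algebraMap ℚ_[p] (PadicCompletedAlgClosure F p hp)), ← map_sub,
        norm_algebraMap_padic]
      exact hχ σ hσ
    set w : PadicCompletedAlgClosure F p hp := PadicExp.plog a with hw
    have hwr : ‖w‖ < r := by rw [hw, norm_plog_of_norm_one_sub_lt_radius (p := p) ha1]; exact ha1
    have hexpw : exp w = a := exp_plog_of_norm_one_sub_lt_radius (p := p) ha1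
    have hNw : ‖(N : PadicCompletedAlgClosure F p hp) * w‖ < r :=
      lt_of_le_of_lt ((norm_mul_le _ _).trans
        (mul_le_of_le_one_left (norm_nonneg _) (norm_natCast_le_one _ N))) hwr
    have hgz : gal hp σ z = z + (N : PadicCompletedAlgClosure F p hp) * w := by
      rw [hz, map_mul, gal_natCast, hw, hc σ hσ]; ring
    rw [hu, gal_exp hp σ hzr, hgz, exp_add_of_norm_lt_radius (p := p) hzr hNw,
      exp_natCast_mul_of_norm_lt_radius (p := p) hwr N, hexpw, mul_comm]
  -- transport to `ℂ_F` and apply Tate's `H⁰ = 0`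
  have hx : ∀ σ : absoluteGaloisGroup F, (∀ y ∈ M, σ • y = y) → σ • toC hp u =
      (algebraMap F (CompletedAlgClosure F)
        (LocalField.padicRingHom F p hp
          (((GaloisRep.cyclotomicCharacter F p σ : ℤ_[p]ˣ) : ℤ_[p]) : ℚ_[p]))) ^ N * toC hp u := by
    intro σ hσ
    rw [← toC_gal, hgal σ hσ, map_mul, map_pow, algebraMap_padic_apply]
  have hu' : toC hp u = 0 :=
    CompletedAlgClosure.eq_zero_of_forall_fixing_smul_eq_cyclotomicCharacter_pow hp M hN0 hx
  exact hu0 ((map_eq_zero_iff (toC hp) (toC hp).injective).mp hu')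

/-- **Variant with an invariant multiplier**: there is no `c ∈ ℂ_F` and no `H`-invariant `m ≠ 0` with
`m · plog(ι χ(σ)) = σ(c) − c` for all `σ ∈ H = Gal(F̄/M)` (divide by `m`). This is the form in which the
non-vanishing of `[log χ]` is used in Tate's local-algebraicity theorem (Serre III-A.6: a relation
`(n − k)·[log χ] = 0` in `H¹(H, ℂ_F)` forces `n = k`). [cite: SerreAbelianLadic1968, Ch. III §A.6] -/
theorem not_exists_mul_plog_cyclotomicCharacter_eq_gal_sub (M : IntermediateField F (NormedAlgClosure F))
    [FiniteDimensional F M]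
    (hχ : ∀ σ : absoluteGaloisGroup F, (∀ y ∈ M, σ • y = y) →
      ‖(1 : ℚ_[p]) - (((GaloisRep.cyclotomicCharacter F p σ : ℤ_[p]ˣ) : ℤ_[p]) : ℚ_[p])‖ <
        (p : ℝ) ^ (-(1 : ℝ) / ((p : ℝ) - 1)))
    {m : PadicCompletedAlgClosure F p hp} (hm : m ≠ 0)
    (hmfix : ∀ σ : absoluteGaloisGroup F, (∀ y ∈ M, σ • y = y) → gal hp σ m = m) :
    ¬ ∃ c : PadicCompletedAlgClosure F p hp, ∀ σ : absoluteGaloisGroup F, (∀ y ∈ M, σ • y = y) →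
      m * PadicExp.plog (algebraMap ℚ_[p] (PadicCompletedAlgClosure F p hp)
        (((GaloisRep.cyclotomicCharacter F p σ : ℤ_[p]ˣ) : ℤ_[p]) : ℚ_[p])) = gal hp σ c - c := by
  rintro ⟨c, hc⟩
  refine not_exists_plog_cyclotomicCharacter_eq_gal_sub hp M hχ ⟨m⁻¹ * c, fun σ hσ => ?_⟩
  rw [map_mul, map_inv₀, hmfix σ hσ, ← mul_sub, ← hc σ hσ, ← mul_assoc, inv_mul_cancel₀ hm, one_mul]

end PadicCompletedAlgClosure

end Literature.NumberTheory.PAdicHodge
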